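import Mathlib
import HarnessLib
import Summits.Ventures.LatticeQCDFlow.Exactness.SU2FixedPointInverse

/-!
# The engine's layer inverse: iterating all active links of a masked `SU(2)` kick layer from the output field converges to the layer's preimage

HONEST FRAMING: exact (Metropolis-corrected) sampling algorithms for lattice gauge theory;
figures of merit are autocorrelation/cost numbers at stated couplings and volumes; no
continuum-physics claim.

Venture `LatticeQCDFlow` (cell pub-lqcd), topic `Exactness`; FANOUT row 14 (`eng-flowhmc`, engine
`latflow.fthmc`, family B; `maps.wflow_substep_inverse_flat` / `resid_substep_inverse_flat`:
"invert ONE sub-step on `(mu, p)` by the fixed-point iteration … `R` read from the OUTPUT field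
(frozen links) … `Ul = fori_loop(0, n_iter, U ↦ expm(-Q_of(U)) @ Ul_out, Ul_out)`").  NEW WORK of
the cell; nothing is cited as a fact; no number.  `SU2FixedPointInverse.lean` did one link with a
fixed local field.  Here: the whole masked layer of `SU2MaskedKickLayer.lean` (links `ι`, mask
`p`, FROZEN field `J`, refusal rule `|ε|‖J‖ ≤ 1` at active links), iterated exactly as the engine
does — every active link in parallel, the field read from the output configuration `W`, the
iteration started at `W`:

* `su2MaskedKick_layerIterate_apply` — the layer iteration IS the per-link iteration at active
  links (and leaves the frozen links at `W`);
* **`su2MaskedKick_layerInverse_converges`** — there is a configuration `V⋆`, equal to `W` on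
  the frozen links, with `F(V⋆) = W` (the layer's preimage; `F V = W → V = V⋆`), and after `n`
  iterations every link is within `2 (|ε|‖J W i‖)ⁿ ≤ 2κⁿ` of `V⋆` in quaternion coordinates.
  Reading the field from the OUTPUT is legitimate precisely because the field is frozen
  (`J V⋆ i = J W i` at active `i`); `su2MaskedKick_layerInverse_tendsto` — inside the strict
  refusal rule `|ε|‖J‖ < 1` the iterates converge to `V⋆` at every link.

NOT CLAIMED: floating point; that a given `n_iter` meets a given residual; `SU(N ≥ 3)`; any number.
-/

noncomputable section

namespace Summit.Ventures.LatticeQCDFlow.Exactness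

open Real InnerProductGeometry WithLp
open Literature.MathematicalPhysics.QuantumFieldTheory
open scoped Matrix

variable {ι : Type*} (p : ι → Prop) [DecidablePred p]

/-- **The engine's layer iteration is the per-link iteration.**  Iterating
`V ↦ (i ↦ if p i then V i · kick_{J W i}(V i)⁻¹ · W i else W i)` `n` times from `W` gives, at an
active link, the `n`-th iterate of that link's fixed-point map started at `W i`, and `W i` at a
frozen link. -/
theorem su2MaskedKick_layerIterate_apply (ε : ℝ) (J : (ι → Matrix.specialUnitaryGroup (Fin 2) ℂ) → ι → R4)
    (W : ι → Matrix.specialUnitaryGroup (Fin 2) ℂ) (n : ℕ) (i : ι) :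
    ((fun (V : ι → Matrix.specialUnitaryGroup (Fin 2) ℂ) (i : ι) => if p i then V i * (gaussUnit (geodesicKick ε (J W i) (vecQuat ((V i : Matrix.specialUnitaryGroup (Fin 2) ℂ) : Matrix (Fin 2) (Fin 2) ℂ))))⁻¹ * W i else W i)^[n] W) i =
      if p i then (fun U : Matrix.specialUnitaryGroup (Fin 2) ℂ => U * (gaussUnit (geodesicKick ε (J W i) (vecQuat ((U : Matrix.specialUnitaryGroup (Fin 2) ℂ) : Matrix (Fin 2) (Fin 2) ℂ))))⁻¹ * W i)^[n] (W i) else W i := by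
  induction n with
  | zero => simp
  | succ n ih =>
    rw [Function.iterate_succ_apply', Function.iterate_succ_apply']
    by_cases hi : p i
    · simp only [if_pos hi, ih]
    · simp only [if_neg hi]

/-- **The engine's layer inverse converges to the layer's preimage.**  Masked `SU(2)` kick layer
with a FROZEN field `J` (equal at active links on configurations agreeing on the frozen links)
inside `|ε| ‖J V i‖ ≤ 1` at active links; target (output) configuration `W`.  There is `V⋆` with:
`V⋆ = W` on frozen links; `F(V⋆) = W` for the layer `F`; it is the ONLY preimage; and the engine's
iteration (all active links in parallel, field read from `W`, started at `W`) satisfies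
`‖(𝒯ⁿ W) i − V⋆ i‖ ≤ 2 (|ε| ‖J W i‖)ⁿ` at every link, for every `n`. -/
theorem su2MaskedKick_layerInverse_converges {ε : ℝ} (J : (ι → Matrix.specialUnitaryGroup (Fin 2) ℂ) → ι → R4)
    (hJloc : ∀ V W : ι → Matrix.specialUnitaryGroup (Fin 2) ℂ,
      (∀ j, ¬p j → V j = W j) → ∀ i, p i → J V i = J W i)
    (hκ : ∀ (V : ι → Matrix.specialUnitaryGroup (Fin 2) ℂ) (i : ι), p i → |ε| * ‖J V i‖ ≤ 1)
    (W : ι → Matrix.specialUnitaryGroup (Fin 2) ℂ) :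
    ∃ Vstar : ι → Matrix.specialUnitaryGroup (Fin 2) ℂ,
      (∀ i, ¬p i → Vstar i = W i) ∧
      (fun i : ι => if p i then gaussUnit (geodesicKick ε (J Vstar i) (vecQuat ((Vstar i : Matrix.specialUnitaryGroup (Fin 2) ℂ) : Matrix (Fin 2) (Fin 2) ℂ))) else Vstar i) = W ∧
      (∀ V : ι → Matrix.specialUnitaryGroup (Fin 2) ℂ,
        (fun i : ι => if p i then gaussUnit (geodesicKick ε (J V i) (vecQuat ((V i : Matrix.specialUnitaryGroup (Fin 2) ℂ) : Matrix (Fin 2) (Fin 2) ℂ))) else V i) = W → V = Vstar) ∧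
      ∀ (n : ℕ) (i : ι),
        ‖vecQuat ((((fun (V : ι → Matrix.specialUnitaryGroup (Fin 2) ℂ) (i : ι) => if p i then V i * (gaussUnit (geodesicKick ε (J W i) (vecQuat ((V i : Matrix.specialUnitaryGroup (Fin 2) ℂ) : Matrix (Fin 2) (Fin 2) ℂ))))⁻¹ * W i else W i)^[n] W) i : Matrix.specialUnitaryGroup (Fin 2) ℂ) : Matrix (Fin 2) (Fin 2) ℂ) - vecQuat ((Vstar i : Matrix.specialUnitaryGroup (Fin 2) ℂ) : Matrix (Fin 2) (Fin 2) ℂ)‖ ≤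
          2 * (|ε| * ‖J W i‖) ^ n := by
  classical
  -- one link at a time: the fixed-point theorem with the field read from `W`
  have key : ∀ i, p i → ∃ Ustar : Matrix.specialUnitaryGroup (Fin 2) ℂ, gaussUnit (geodesicKick ε (J W i) (vecQuat ((Ustar : Matrix.specialUnitaryGroup (Fin 2) ℂ) : Matrix (Fin 2) (Fin 2) ℂ))) = W i ∧
      (∀ V : Matrix.specialUnitaryGroup (Fin 2) ℂ, gaussUnit (geodesicKick ε (J W i) (vecQuat ((V : Matrix.specialUnitaryGroup (Fin 2) ℂ) : Matrix (Fin 2) (Fin 2) ℂ))) = W i → V = Ustar) ∧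
      ∀ n : ℕ, ‖vecQuat (((fun U : Matrix.specialUnitaryGroup (Fin 2) ℂ => U * (gaussUnit (geodesicKick ε (J W i) (vecQuat ((U : Matrix.specialUnitaryGroup (Fin 2) ℂ) : Matrix (Fin 2) (Fin 2) ℂ))))⁻¹ * W i)^[n] (W i) : Matrix.specialUnitaryGroup (Fin 2) ℂ) : Matrix (Fin 2) (Fin 2) ℂ) -
          vecQuat ((Ustar : Matrix.specialUnitaryGroup (Fin 2) ℂ) : Matrix (Fin 2) (Fin 2) ℂ)‖ ≤ 2 * (|ε| * ‖J W i‖) ^ n :=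
    fun i hi => su2FixedPoint_converges ε (J W i) (hκ W i hi) (W i) (W i)
  choose! Ust hUst hUuniq hUrate using key
  refine ⟨fun i => if p i then Ust i else W i, fun i hi => if_neg hi, ?_, ?_, ?_⟩
  · -- `F V⋆ = W`: the field at `V⋆` is the field at `W` (frozen links agree)
    have hJ : ∀ i, p i → J (fun i => if p i then Ust i else W i) i = J W i :=
      hJloc _ W (fun j hj => if_neg hj)
    funext i
    by_cases hi : p i
    · simp only [if_pos hi, hJ i hi]
      exact hUst i hi
    · simp only [if_neg hi]
  · -- uniqueness: a preimage agrees with `W` off the mask, so its field is `J W`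
    intro V hV
    have hoff : ∀ j, ¬p j → V j = W j := fun j hj => by
      have h := congr_fun hV j
      simpa only [if_neg hj] using h
    have hJ : ∀ i, p i → J V i = J W i := hJloc V W hoff
    funext i
    by_cases hi : p i
    · have h := congr_fun hV i
      simp only [if_pos hi, hJ i hi] at h
      simp only [if_pos hi]
      exact hUuniq i hi (V i) h
    · simp only [if_neg hi]
      exact hoff i hi
  · intro n i
    rw [su2MaskedKick_layerIterate_apply]
    by_cases hi : p i
    · simp only [if_pos hi]
      exact hUrate i hi n
    · simp only [if_neg hi, sub_self, norm_zero]
      positivity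

/-- **Hence the engine's layer inverse converges** (strict refusal rule `|ε| ‖J‖ < 1` at active
links): at every link the iterates tend to the preimage `V⋆` in quaternion coordinates. -/
theorem su2MaskedKick_layerInverse_tendsto {ε : ℝ} (J : (ι → Matrix.specialUnitaryGroup (Fin 2) ℂ) → ι → R4)
    (hJloc : ∀ V W : ι → Matrix.specialUnitaryGroup (Fin 2) ℂ,
      (∀ j, ¬p j → V j = W j) → ∀ i, p i → J V i = J W i)
    (hκ : ∀ (V : ι → Matrix.specialUnitaryGroup (Fin 2) ℂ) (i : ι), p i → |ε| * ‖J V i‖ < 1)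
    (W : ι → Matrix.specialUnitaryGroup (Fin 2) ℂ) :
    ∃ Vstar : ι → Matrix.specialUnitaryGroup (Fin 2) ℂ,
      (fun i : ι => if p i then gaussUnit (geodesicKick ε (J Vstar i) (vecQuat ((Vstar i : Matrix.specialUnitaryGroup (Fin 2) ℂ) : Matrix (Fin 2) (Fin 2) ℂ))) else Vstar i) = W ∧
      ∀ i : ι, Filter.Tendsto
        (fun n : ℕ => vecQuat ((((fun (V : ι → Matrix.specialUnitaryGroup (Fin 2) ℂ) (i : ι) => if p i then V i * (gaussUnit (geodesicKick ε (J W i) (vecQuat ((V i : Matrix.specialUnitaryGroup (Fin 2) ℂ) : Matrix (Fin 2) (Fin 2) ℂ))))⁻¹ * W i else W i)^[n] W) i : Matrix.specialUnitaryGroup (Fin 2) ℂ) : Matrix (Fin 2) (Fin 2) ℂ))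
        Filter.atTop (nhds (vecQuat ((Vstar i : Matrix.specialUnitaryGroup (Fin 2) ℂ) : Matrix (Fin 2) (Fin 2) ℂ))) := by
  obtain ⟨Vstar, hoff, hF, -, hrate⟩ :=
    su2MaskedKick_layerInverse_converges p J hJloc (fun V i hi => (hκ V i hi).le) W
  refine ⟨Vstar, hF, fun i => ?_⟩
  by_cases hi : p i
  · have hκ0 : 0 ≤ |ε| * ‖J W i‖ := mul_nonneg (abs_nonneg ε) (norm_nonneg _)
    have h0 : Filter.Tendsto (fun n : ℕ => 2 * (|ε| * ‖J W i‖) ^ n) Filter.atTop (nhds 0) := by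
      have h := (tendsto_pow_atTop_nhds_zero_of_lt_one hκ0 (hκ W i hi)).const_mul 2
      rwa [mul_zero] at h
    rw [tendsto_iff_norm_sub_tendsto_zero]
    exact squeeze_zero (fun n => norm_nonneg _) (fun n => hrate n i) h0
  · have hconst : ∀ n : ℕ, ((fun (V : ι → Matrix.specialUnitaryGroup (Fin 2) ℂ) (i : ι) => if p i then V i * (gaussUnit (geodesicKick ε (J W i) (vecQuat ((V i : Matrix.specialUnitaryGroup (Fin 2) ℂ) : Matrix (Fin 2) (Fin 2) ℂ))))⁻¹ * W i else W i)^[n] W) i = Vstar i := fun n => by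
      rw [su2MaskedKick_layerIterate_apply, if_neg hi, hoff i hi]
    simp only [hconst]
    exact tendsto_const_nhds

end Summit.Ventures.LatticeQCDFlow.Exactness
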